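import Literature.NumberTheory.EllipticCurves.MordellCurvePhiDescentHom
import Mathlib.RingTheory.Valuation.Basic
import Mathlib.Algebra.GroupWithZero.WithZero
import HarnessLib

/-!
# Local conditions on the `φ`-descent values `Y + B` of `Y² = X³ + B²`

Topic `NumberTheory/EllipticCurves`. For the `φ`-descent map `δ : (X, Y) ↦ Y + B` on the Mordell
curve `E'_B : Y² = X³ + B²` (tree `MordellDescent.cubicDescent`: `O ↦ 1`, `−T' = (0, −B) ↦ (2B)²;
Cassels 1964, Silverman *AEC* X.4) over a field `L` with a `ℤᵐ⁰`-valued valuation `v`, the local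
image of `δ` is confined by elementary valuation arguments on the factorisation
`(Y + B)(Y − B) = X³`, `(Y + B) − (Y − B) = 2B` (Silverman, *AEC*, proof of Thm. X.1.1(c) and
Exercise 10.9 for the `3`-isogeny descent). Abstractly, for ANY valuation `v`:

* `Valuation.three_dvd_log_cubicDescent_of_dvd`: if `3 ∣ ord_v(2B)` then `3 ∣ ord_v(δ(P))` for
  every point `P` (the tree's `three_dvd_log_cubicDescent` is the case `ord_v(2B) = 0`; the case
  `ord_v(2B) = 3` is the condition at `2` for the cubic twists `y² = x³ + (4m)²`);
* `MordellDescent.IsResidueChar`: a function `χ : L → ℤ/3ℤ` multiplicative on `Lˣ`, constant on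
  `{y : v(y − x) < v(x)}` ("depends only on the leading `v`-adic digit") and vanishing on `2B`
  and `−1` — the shape of the cubic residue character of the unit part at a prime `p ≡ 2 (mod 3)`
  inert in `ℚ(ζ₃)`;
* `MordellDescent.IsResidueChar.apply_cubicDescent_eq_zero`: for such `χ` with `χ(B) = 0`,
  `χ(δ(P)) = 0` for every `P`, provided the only multiple of `3` in the window
  `[ord_v(B), ord_v(2B)]` is (at most) `ord_v(B) < ord_v(2B)` itself — covering `B` a `v`-unit with
  `ord_v(2) = 1` (`t` odd at `2`), `ord_v(B) = ord_v(2) = 1` (`t = 2m` at `2`), and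
  `ord_v(B) ∈ {1, 2}`, `ord_v(2) = 0` (`t = 5m, 25m` at `5`);
* `MordellDescent.IsDigitChar` / `IsDigitChar.apply_cubicDescent_eq_zero`: the analogue for a
  character of LEVEL THREE — constant on `{y : v(y − x) ≤ v(x)·exp(−3)}`, i.e. on units it
  factors through `U/(1 + 𝔪_v³)` — killing `−1` and `2B`, at a place where `B` and `2` are units:
  `χ(δ(P)) = 0` for all `P` as soon as `χ(β) = 0` whenever `β`, `β − 2B` and `X` are units with
  `β(β − 2B) = X³` (a finite check in the residue ring `𝓞_v/𝔪_v³`). This is the shape of the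
  condition at `λ = 1 − ζ₃` for `y² = x³ + t²`, `t ≡ ±4 (mod 9)`: there `U¹/(U¹)³ = U¹/U⁴ ≅ 𝔽₃³`
  (`U^i = 1 + λ^i𝓞_λ`), and the functional needed is one that VANISHES on `U³/U⁴`, hence has
  level three; the general cubic residue symbol at `λ` (level four) is NOT of this shape.

Pure valuation theory; the characters are axiomatised (`structure … : Prop`) and instantiated for
`ℚ(ζ₃)` elsewhere. `ord_v = log ∘ v` up to sign (Mathlib's normalised valuations are `exp(−ord_v)`).

## References

* J. H. Silverman, *The Arithmetic of Elliptic Curves*, 2nd ed., GTM 106 (2009), Thm. X.1.1(c),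
  Prop. X.4.9, Exercise 10.9 (descent via a `3`-isogeny on `y² = x³ + D`). [SilvermanAEC2009]
* J. W. S. Cassels, *Arithmetic on curves of genus 1. VI*, J. reine angew. Math. 214/215 (1964),
  p. 65 (the descent map `Y + 9c` modulo cubes). [Cassels1964ArithmeticVI]
-/

open scoped WithZero

open WithZero (log exp)

/-! ### Valuations: `log` bookkeeping -/

namespace Valuation

variable {L : Type*} [Field L] (v : Valuation L ℤᵐ⁰)

/-- `log v(xy) = log v(x) + log v(y)` (`x, y ≠ 0`). [folklore] -/
theorem log_map_mul {x y : L} (hx : x ≠ 0) (hy : y ≠ 0) :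
    log (v (x * y)) = log (v x) + log (v y) := by
  rw [map_mul, WithZero.log_mul ((v.ne_zero_iff).mpr hx) ((v.ne_zero_iff).mpr hy)]

/-- `log v(xⁿ) = n log v(x)`. [folklore] -/
theorem log_map_pow (x : L) (n : ℕ) : log (v (x ^ n)) = n * log (v x) := by
  rw [map_pow, WithZero.log_pow, nsmul_eq_mul]

/-- `v x < v y ↔ log v x < log v y` (`x, y ≠ 0`). [folklore] -/
theorem lt_iff_log_lt {x y : L} (hx : x ≠ 0) (hy : y ≠ 0) :
    v x < v y ↔ log (v x) < log (v y) :=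
  (WithZero.log_lt_log ((v.ne_zero_iff).mpr hx) ((v.ne_zero_iff).mpr hy)).symm

/-- `v x ≤ v y ↔ log v x ≤ log v y` (`x, y ≠ 0`). [folklore] -/
theorem le_iff_log_le {x y : L} (hx : x ≠ 0) (hy : y ≠ 0) :
    v x ≤ v y ↔ log (v x) ≤ log (v y) :=
  (WithZero.log_le_log ((v.ne_zero_iff).mpr hx) ((v.ne_zero_iff).mpr hy)).symm

/-- `v x = v y ↔ log v x = log v y` (`x, y ≠ 0`). [folklore] -/
theorem eq_iff_log_eq {x y : L} (hx : x ≠ 0) (hy : y ≠ 0) :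
    v x = v y ↔ log (v x) = log (v y) := by
  refine ⟨fun h ↦ by rw [h], fun h ↦ ?_⟩
  rw [← WithZero.exp_log ((v.ne_zero_iff).mpr hx), ← WithZero.exp_log ((v.ne_zero_iff).mpr hy), h]

/-- **Ultrametric inequality in `log` form**: `log v(x + y) ≤ max (log v x) (log v y)`
(`x, y, x + y ≠ 0`). [folklore] -/
theorem log_map_add_le_max {x y : L} (hx : x ≠ 0) (hy : y ≠ 0) (hxy : x + y ≠ 0) :
    log (v (x + y)) ≤ max (log (v x)) (log (v y)) := by
  rcases le_total (v x) (v y) with h | h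
  · have := v.map_add x y
    rw [max_eq_right h] at this
    exact le_max_of_le_right ((v.le_iff_log_le hxy hy).mp this)
  · have := v.map_add x y
    rw [max_eq_left h] at this
    exact le_max_of_le_left ((v.le_iff_log_le hxy hx).mp this)

/-- **Equality case**: `v x ≠ v y ⟹ log v(x + y) = max (log v x) (log v y)` (`x, y ≠ 0`).
[folklore] -/
theorem log_map_add_eq_max {x y : L} (hx : x ≠ 0) (hy : y ≠ 0) (h : v x ≠ v y) :
    log (v (x + y)) = max (log (v x)) (log (v y)) := by
  rw [v.map_add_of_distinct_val h]
  rcases le_total (v x) (v y) with h' | h'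
  · rw [max_eq_right h', max_eq_right ((v.le_iff_log_le hx hy).mp h')]
  · rw [max_eq_left h', max_eq_left ((v.le_iff_log_le hy hx).mp h')]

/-! ### `3 ∣ ord_v(2B) ⟹ 3 ∣ ord_v(δ(P))` -/

/-- **`a b = x³`, `3 ∣ ord_v(a − b)` ⟹ `3 ∣ ord_v(a)`** (`a, b, a − b ≠ 0`): if `v a ≠ v b` then
`ord(a − b) ∈ {ord a, ord b}` is the smaller of the two and `ord a + ord b = 3 ord x`; if
`v a = v b` then `2 ord a = 3 ord x` (`a, b ≠ 0`). [cite: SilvermanAEC2009, Thm. X.1.1(c)] -/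
theorem three_dvd_log_of_mul_eq_cube_of_dvd {a b x : L} (ha : a ≠ 0) (hb : b ≠ 0)
    (hsub : (3 : ℤ) ∣ log (v (a - b))) (h : a * b = x ^ 3) : (3 : ℤ) ∣ log (v a) := by
  have hx : x ≠ 0 := by
    rintro rfl
    rw [zero_pow three_ne_zero, mul_eq_zero] at h
    exact h.elim ha hb
  have hprod : log (v a) + log (v b) = 3 * log (v x) := by
    rw [← v.log_map_mul ha hb, h, v.log_map_pow]; norm_cast
  by_cases hab : v a = v b
  · rw [v.eq_iff_log_eq ha hb] at hab
    exact ⟨log (v a) - log (v x), by omega⟩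
  · have hmax : log (v (a - b)) = max (log (v a)) (log (v b)) := by
      rw [sub_eq_add_neg, v.log_map_add_eq_max ha (neg_ne_zero.mpr hb) (by rwa [map_neg]), map_neg]
    rcases le_total (log (v a)) (log (v b)) with hle | hle
    · rw [max_eq_right hle] at hmax
      rw [hmax] at hsub
      obtain ⟨k, hk⟩ := hsub
      exact ⟨log (v x) - k, by omega⟩
    · rw [max_eq_left hle] at hmax
      rwa [hmax] at hsub

open Literature.NumberTheory.EllipticCurves Literature.NumberTheory.EllipticCurves.MordellDescent
  WeierstrassCurve in
/-- **`3 ∣ ord_v(2B) ⟹ 3 ∣ ord_v(δ(P))` for every point `P` of `E'_B : Y² = X³ + B²`**, `δ` the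
`φ`-descent map `MordellDescent.cubicDescent` (`(X, Y) ↦ Y + B`, `O ↦ 1`, `−T' ↦ (2B)²`): off
`X = 0`, `(Y + B)(Y − B) = X³` with `(Y + B) − (Y − B) = 2B`
(`three_dvd_log_of_mul_eq_cube_of_dvd`); at `O, ±T'` the values are `1, 2B, (2B)²`. The case
`ord_v(2B) = 0` is the tree's `three_dvd_log_cubicDescent` (every place not dividing `2B`); the
case `ord_v(2B) = 3` is the local condition at `2` for `B = 4m`, `m` odd.
[cite: SilvermanAEC2009, Thm. X.1.1(c), Exercise 10.9] -/
theorem three_dvd_log_cubicDescent_of_dvd {W : WeierstrassCurve L} {B : L}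
    (hW : W = mordellCurve (B ^ 2)) (hB : B ≠ 0) (h2 : (2 : L) ≠ 0)
    (hv : (3 : ℤ) ∣ log (v (2 * B))) (P : W.toAffine.Point) :
    (3 : ℤ) ∣ log (v (cubicDescent W B P)) := by
  have h2B : (2 : L) * B ≠ 0 := mul_ne_zero h2 hB
  rcases P with _ | ⟨X, Y, hP⟩
  · rw [← Affine.Point.zero_def, cubicDescent_zero, map_one, WithZero.log_one]; exact dvd_zero 3
  · have hE : Y ^ 2 = X ^ 3 + B ^ 2 := (equation_iff_of_eq hW X Y).mp hP.1
    rw [cubicDescent_some]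
    split_ifs with hY
    · rw [v.log_map_pow]; exact Dvd.dvd.mul_left hv 2
    · by_cases hX : X = 0
      · have hYB : Y = B := by
          rcases y_eq_or_of_x_eq_zero hW hP.1 hX with h | h
          · exact h
          · exact absurd h hY
        rw [hYB, ← two_mul]; exact hv
      · refine v.three_dvd_log_of_mul_eq_cube_of_dvd (b := Y - B) (x := X) (fun h ↦ hY ?_)
          (fun h ↦ hX ?_) (by rw [show Y + B - (Y - B) = 2 * B by ring]; exact hv) ?_
        · linear_combination h
        · have : X ^ 3 = 0 := by
            have hYB : Y = B := by linear_combination h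
            rw [hYB] at hE; linear_combination hE.symm
          exact pow_eq_zero_iff three_ne_zero |>.mp this
        · linear_combination hE

end Valuation

/-! ### Residue characters: `χ(δ(P)) = 0` -/

namespace Literature.NumberTheory.EllipticCurves

namespace MordellDescent

open WeierstrassCurve

variable {L : Type*} [Field L]

/-- **A `ℤ/3ℤ`-valued residue character of level one** for a valuation `v`: multiplicative on
`Lˣ`, unchanged under perturbations of smaller valuation (`v(y − x) < v(x) ⟹ χ y = χ x`: `χ`
depends only on the valuation and the leading digit), and killing `−1`. (The cubic residue
character of the unit part at a prime `p ≡ 2 (mod 3)` inert in `ℚ(ζ₃)` has this shape.)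
[folklore] -/
structure IsResidueChar (v : Valuation L ℤᵐ⁰) (χ : L → ZMod 3) : Prop where
  /-- `χ(xy) = χ(x) + χ(y)` for `x, y ≠ 0`. -/
  map_mul : ∀ {x y : L}, x ≠ 0 → y ≠ 0 → χ (x * y) = χ x + χ y
  /-- `χ` is constant on `{y : v(y − x) < v(x)}`. -/
  eq_of_lt : ∀ {x y : L}, v (y - x) < v x → χ y = χ x
  /-- `χ(−1) = 0`. -/
  map_neg_one : χ (-1) = 0

namespace IsResidueChar

variable {v : Valuation L ℤᵐ⁰} {χ : L → ZMod 3} (hχ : IsResidueChar v χ)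
include hχ

/-- `χ(1) = 0`. [folklore] -/
theorem map_one : χ 1 = 0 := by
  have h := hχ.map_mul one_ne_zero one_ne_zero
  rw [mul_one] at h
  have h3 : ∀ a : ZMod 3, a = a + a → a = 0 := by decide
  exact h3 _ h

/-- `χ(x³) = 0`. [folklore] -/
theorem map_pow_three {x : L} (hx : x ≠ 0) : χ (x ^ 3) = 0 := by
  rw [pow_succ, pow_two, hχ.map_mul (mul_ne_zero hx hx) hx, hχ.map_mul hx hx]
  have h3 : ∀ a : ZMod 3, a + a + a = 0 := by decide
  exact h3 _

/-- `χ(x²) = 0 ⟹ χ(x) = 0` (`3` is odd). [folklore] -/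
theorem eq_zero_of_sq {x : L} (hx : x ≠ 0) (h : χ (x ^ 2) = 0) : χ x = 0 := by
  rw [pow_two, hχ.map_mul hx hx] at h
  have h3 : ∀ a : ZMod 3, a + a = 0 → a = 0 := by decide
  exact h3 _ h

/-- `χ(−x) = χ(x)`. [folklore] -/
theorem map_neg {x : L} (hx : x ≠ 0) : χ (-x) = χ x := by
  rw [← neg_one_mul, hχ.map_mul (by norm_num) hx, hχ.map_neg_one, zero_add]

/-- **`χ(δ(P)) = 0` on `E'_B : Y² = X³ + B²`** for a level-one residue character `χ` of `v` with
`χ(B) = χ(2B) = 0`, at a place where the window `[v(2B), v(B)]` contains no cube valuation other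
than possibly `v(B)` itself with `v(2B) < v(B)` (hypothesis `hwin`). Cases on `v(Y)` against
`v(B)`: if `v(Y) > v(B)` then `χ(Y ± B) = χ(Y)` and `2χ(Y) = 3χ(X) = 0`; if `v(Y) < v(B)` then
`χ(Y + B) = χ(B) = 0`; if `v(Y) = v(B)` and `v(Y + B) ≠ v(Y − B)` then the larger is `v(2B)` and
`χ(Y + B) = χ(2B)` or `χ(Y − B) = χ(−2B)`; if `v(Y + B) = v(Y − B)` it is a cube valuation in the
window, hence `= v(B) > v(2B)` and `χ(Y + B) = χ(Y − B)`, so `2χ(Y + B) = 0`. Instances: `B` a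
`v`-unit and `v(2) = exp(−1)`; `v(B) = v(2) = exp(−1)`; `v(B) ∈ {exp(−1), exp(−2)}` and `2` a
`v`-unit. [cite: SilvermanAEC2009, Exercise 10.9] -/
theorem apply_cubicDescent_eq_zero {W : WeierstrassCurve L} {B : L}
    (hW : W = mordellCurve (B ^ 2)) (hB : B ≠ 0) (h2 : (2 : L) ≠ 0)
    (hχB : χ B = 0) (hχ2B : χ (2 * B) = 0)
    (hwin : ∀ n : ℤ, log (v (2 * B)) ≤ n → n ≤ log (v B) → (3 : ℤ) ∣ n →
      n = log (v B) ∧ v (2 * B) < v B)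
    (P : W.toAffine.Point) : χ (cubicDescent W B P) = 0 := by
  have h2B : (2 : L) * B ≠ 0 := mul_ne_zero h2 hB
  rcases P with _ | ⟨X, Y, hP⟩
  · rw [← Affine.Point.zero_def, cubicDescent_zero]; exact hχ.map_one
  have hE : Y ^ 2 = X ^ 3 + B ^ 2 := (equation_iff_of_eq hW X Y).mp hP.1
  rw [cubicDescent_some]
  split_ifs with hY
  · rw [pow_two, hχ.map_mul h2B h2B, hχ2B, add_zero]
  -- `P = (X, Y)` with `Y + B ≠ 0`
  have ha : Y + B ≠ 0 := fun h ↦ hY (by linear_combination h)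
  by_cases hX : X = 0
  · have hYB : Y = B := by
      rcases y_eq_or_of_x_eq_zero hW hP.1 hX with h | h
      · exact h
      · exact absurd h hY
    rw [hYB, ← two_mul]; exact hχ2B
  have hb : Y - B ≠ 0 := by
    intro h
    have hYB : Y = B := by linear_combination h
    rw [hYB] at hE
    exact hX (pow_eq_zero_iff three_ne_zero |>.mp (by linear_combination -hE))
  -- the factorisation `(Y + B)(Y - B) = X³`
  have hprod : (Y + B) * (Y - B) = X ^ 3 := by linear_combination hE
  have hsum : χ (Y + B) + χ (Y - B) = 0 := by
    rw [← hχ.map_mul ha hb, hprod, hχ.map_pow_three hX]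
  have hlog : log (v (Y + B)) + log (v (Y - B)) = 3 * log (v X) := by
    rw [← v.log_map_mul ha hb, hprod, v.log_map_pow]; norm_cast
  have h3 : ∀ a b : ZMod 3, a + b = 0 → b = 0 → a = 0 := by decide
  have h3' : ∀ a : ZMod 3, a + a = 0 → a = 0 := by decide
  by_cases hY0 : Y = 0
  · subst hY0; rw [zero_add]; exact hχB
  rcases lt_trichotomy (v B) (v Y) with hlt | heq | hgt
  · -- `v Y > v B`: `χ(Y ± B) = χ(Y)` and `2 χ(Y) = 3 χ(X) = 0`
    have h1 : χ (Y + B) = χ Y := hχ.eq_of_lt (by rwa [add_sub_cancel_left])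
    have h2 : χ (Y - B) = χ Y := hχ.eq_of_lt (by rwa [sub_sub_cancel_left, Valuation.map_neg])
    rw [h1, h2] at hsum
    rw [h1]; exact h3' _ hsum
  · -- `v Y = v B`
    have hva : v (Y + B) ≤ v B :=
      (v.map_add Y B).trans (by rw [← heq, max_self])
    have hvb : v (Y - B) ≤ v B :=
      (v.map_sub Y B).trans (by rw [← heq, max_self])
    by_cases hab : v (Y + B) = v (Y - B)
    · -- a cube valuation inside the window: it is `v B > v (2B)`, and `χ(Y + B) = χ(Y - B)`
      have hcube : (3 : ℤ) ∣ log (v (Y + B)) := by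
        rw [(v.eq_iff_log_eq ha hb).mp hab] at hlog ⊢; omega
      have hlow : log (v (2 * B)) ≤ log (v (Y + B)) := by
        refine (v.le_iff_log_le h2B ha).mp ?_
        rw [show (2 : L) * B = (Y + B) - (Y - B) by ring]
        exact (v.map_sub _ _).trans (by rw [← hab, max_self])
      have hup : log (v (Y + B)) ≤ log (v B) := (v.le_iff_log_le ha hB).mp hva
      obtain ⟨hEq, hlt2⟩ := hwin _ hlow hup hcube
      have hvab : v (Y + B) = v B := (v.eq_iff_log_eq ha hB).mpr hEq
      have hc : χ (Y + B) = χ (Y - B) := hχ.eq_of_lt (by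
        rw [show Y + B - (Y - B) = 2 * B by ring, ← hab, hvab]; exact hlt2)
      rw [← hc] at hsum
      exact h3' _ hsum
    · -- distinct valuations: the larger one is `v(2B)`
      have hmax : v (2 * B) = max (v (Y + B)) (v (Y - B)) := by
        rw [show (2 : L) * B = (Y + B) + (-(Y - B)) by ring,
          v.map_add_of_distinct_val (by rwa [Valuation.map_neg]), Valuation.map_neg]
      rcases lt_or_gt_of_ne hab with hlt' | hgt'
      · -- `v(Y + B) < v(Y - B) = v(2B)`: `χ(Y - B) = χ(-2B) = 0`
        have hvb2 : v (Y - B) = v (2 * B) := by rw [hmax, max_eq_right hlt'.le]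
        have hc : χ (Y - B) = χ (-(2 * B)) := hχ.eq_of_lt (by
          rw [show Y - B - -(2 * B) = Y + B by ring, Valuation.map_neg, ← hvb2]; exact hlt')
        rw [hc, hχ.map_neg h2B, hχ2B] at hsum
        exact h3 _ _ hsum rfl
      · -- `v(Y - B) < v(Y + B) = v(2B)`: `χ(Y + B) = χ(2B) = 0`
        have hva2 : v (Y + B) = v (2 * B) := by rw [hmax, max_eq_left hgt'.le]
        have hc : χ (Y + B) = χ (2 * B) := hχ.eq_of_lt (by
          rw [show Y + B - 2 * B = Y - B by ring, ← hva2]; exact hgt')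
        rw [hc, hχ2B]
  · -- `v Y < v B`: `χ(Y + B) = χ(B) = 0`
    rw [hχ.eq_of_lt (x := B) (y := Y + B) (by rwa [add_sub_cancel_right])]; exact hχB

end IsResidueChar

/-! ### Digit characters (level three): `χ(δ(P)) = 0` from a finite check on units -/

/-- **A `ℤ/3ℤ`-valued character of level three** for a valuation `v`: multiplicative on `Lˣ`,
unchanged under perturbations three digits down (`v(y − x) ≤ v(x)·exp(−3) ⟹ χ y = χ x`, so on
units `χ` factors through `U/(1 + 𝔪_v³)`), and killing `−1`. (For `ℚ₃(ζ₃)`, where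
`U¹/(U¹)³ = U¹/U⁴ ≅ 𝔽₃³`, exactly the linear functionals on `U¹/U⁴` vanishing on `U³/U⁴`, read on
unit parts, have this shape — not the general cubic residue symbol at `λ`, which has level four.)
[folklore] -/
structure IsDigitChar (v : Valuation L ℤᵐ⁰) (χ : L → ZMod 3) : Prop where
  /-- `χ(xy) = χ(x) + χ(y)` for `x, y ≠ 0`. -/
  map_mul : ∀ {x y : L}, x ≠ 0 → y ≠ 0 → χ (x * y) = χ x + χ y
  /-- `χ` is constant on `{y : v(y − x) ≤ v(x) exp(−3)}`. -/
  eq_of_le : ∀ {x y : L}, x ≠ 0 → v (y - x) ≤ v x * exp (-3) → χ y = χ x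
  /-- `χ(−1) = 0`. -/
  map_neg_one : χ (-1) = 0

namespace IsDigitChar

variable {v : Valuation L ℤᵐ⁰} {χ : L → ZMod 3} (hχ : IsDigitChar v χ)
include hχ

/-- `χ(1) = 0`. [folklore] -/
theorem map_one : χ 1 = 0 := by
  have h := hχ.map_mul one_ne_zero one_ne_zero
  rw [mul_one] at h
  have h3 : ∀ a : ZMod 3, a = a + a → a = 0 := by decide
  exact h3 _ h

/-- `χ(x³) = 0`. [folklore] -/
theorem map_pow_three {x : L} (hx : x ≠ 0) : χ (x ^ 3) = 0 := by
  rw [pow_succ, pow_two, hχ.map_mul (mul_ne_zero hx hx) hx, hχ.map_mul hx hx]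
  have h3 : ∀ a : ZMod 3, a + a + a = 0 := by decide
  exact h3 _

/-- `χ(−x) = χ(x)`. [folklore] -/
theorem map_neg {x : L} (hx : x ≠ 0) : χ (-x) = χ x := by
  rw [← neg_one_mul, hχ.map_mul (by norm_num) hx, hχ.map_neg_one, zero_add]

/-- **`χ(δ(P)) = 0` on `E'_B : Y² = X³ + B²` for a level-three character**, at a place where `B`
and `2` are `v`-units, given `χ(2B) = 0` and the finite check `hunits`: `χ(β) = 0` whenever
`β, β − 2B, X` are units with `β(β − 2B) = X³`. Cases: `v(Y) > 1` forces `v(Y) ≥ exp 3`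
(`2 ord Y = 3 ord X`), so `χ(Y ± B) = χ(Y)` and `2χ(Y) = χ(X³ + B²) = χ(X³) = 0`; `v(Y) ≤ 1` and
both `Y ± B` units is `hunits`; otherwise exactly one of `Y ± B` is a non-unit, of valuation
`v(X)³ ≤ exp(−3)`, and the other is `≡ ±2B` three digits deep; `hunits` is a finite check in
`𝓞_v/𝔪_v³`. (The condition at `λ = 1 − ζ₃` for `y² = x³ + t²`, `t ≡ ±4 (mod 9)`, where
`2t ≡ ∓1 (mod λ⁴)`, for a level-three functional vanishing on `U³/U⁴`.)
[cite: SilvermanAEC2009, Exercise 10.9] -/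
theorem apply_cubicDescent_eq_zero {W : WeierstrassCurve L} {B : L}
    (hW : W = mordellCurve (B ^ 2)) (hvB : v B = 1) (hv2 : v 2 = 1) (h2 : (2 : L) ≠ 0)
    (hχ2B : χ (2 * B) = 0)
    (hunits : ∀ β X : L, v β = 1 → v (β - 2 * B) = 1 → v X = 1 → β * (β - 2 * B) = X ^ 3 →
      χ β = 0)
    (P : W.toAffine.Point) : χ (cubicDescent W B P) = 0 := by
  have hB : B ≠ 0 := fun h ↦ by rw [h, Valuation.map_zero] at hvB; exact zero_ne_one hvB
  have h2B : (2 : L) * B ≠ 0 := mul_ne_zero h2 hB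
  have hv2B : v (2 * B) = 1 := by rw [Valuation.map_mul, hv2, hvB, one_mul]
  have h3 : ∀ a b : ZMod 3, a + b = 0 → b = 0 → a = 0 := by decide
  have h3' : ∀ a : ZMod 3, a + a = 0 → a = 0 := by decide
  rcases P with _ | ⟨X, Y, hP⟩
  · rw [← Affine.Point.zero_def, cubicDescent_zero]; exact hχ.map_one
  have hE : Y ^ 2 = X ^ 3 + B ^ 2 := (equation_iff_of_eq hW X Y).mp hP.1
  rw [cubicDescent_some]
  split_ifs with hY
  · rw [pow_two, hχ.map_mul h2B h2B, hχ2B, add_zero]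
  have ha : Y + B ≠ 0 := fun h ↦ hY (by linear_combination h)
  by_cases hX : X = 0
  · have hYB : Y = B := by
      rcases y_eq_or_of_x_eq_zero hW hP.1 hX with h | h
      · exact h
      · exact absurd h hY
    rw [hYB, ← two_mul]; exact hχ2B
  have hb : Y - B ≠ 0 := by
    intro h
    have hYB : Y = B := by linear_combination h
    rw [hYB] at hE
    exact hX (pow_eq_zero_iff three_ne_zero |>.mp (by linear_combination -hE))
  have hprod : (Y + B) * (Y - B) = X ^ 3 := by linear_combination hE
  have hprod' : (Y + B) * (Y + B - 2 * B) = X ^ 3 := by linear_combination hE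
  have hsum : χ (Y + B) + χ (Y - B) = 0 := by
    rw [← hχ.map_mul ha hb, hprod, hχ.map_pow_three hX]
  have hlog : log (v (Y + B)) + log (v (Y - B)) = 3 * log (v X) := by
    rw [← v.log_map_mul ha hb, hprod, v.log_map_pow]; norm_cast
  have hlogB : log (v B) = 0 := by rw [hvB, WithZero.log_one]
  have hlog2B : log (v (2 * B)) = 0 := by rw [hv2B, WithZero.log_one]
  by_cases hYbig : 1 < v Y
  · -- `v Y > 1`: `v Y ≥ exp 3`
    have hY0 : Y ≠ 0 := fun h ↦ by rw [h, Valuation.map_zero] at hYbig; exact not_lt_zero hYbig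
    have hva : v (Y + B) = v Y := v.map_add_eq_of_lt_left (by rwa [hvB])
    have hvb : v (Y - B) = v Y := v.map_sub_eq_of_lt_left (by rwa [hvB])
    have hlogY : 0 < log (v Y) := by
      rw [← WithZero.log_one]; exact (WithZero.log_lt_log one_ne_zero ((v.ne_zero_iff).mpr hY0)).mpr hYbig
    have h3Y : 3 ≤ log (v Y) := by rw [hva, hvb] at hlog; omega
    have hle : v B ≤ v Y * exp (-3) := by
      rw [hvB, ← WithZero.exp_log ((v.ne_zero_iff).mpr hY0), ← WithZero.exp_add, ← WithZero.exp_zero,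
        WithZero.exp_le_exp]; omega
    have h1 : χ (Y + B) = χ Y := hχ.eq_of_le hY0 (by rwa [add_sub_cancel_left])
    have h2' : χ (Y - B) = χ Y := hχ.eq_of_le hY0 (by rwa [sub_sub_cancel_left, Valuation.map_neg])
    -- `2 χ(Y) = χ(Y²) = χ(X³ + B²) = χ(X³) = 0`
    have hX3 : X ^ 3 ≠ 0 := pow_ne_zero 3 hX
    have hsq : χ (Y ^ 2) = χ (X ^ 3) := hχ.eq_of_le hX3 (by
      rw [show Y ^ 2 - X ^ 3 = B ^ 2 by linear_combination hE, Valuation.map_pow, hvB, one_pow,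
        ← hprod, Valuation.map_mul, hva, hvb, ← WithZero.exp_log ((v.ne_zero_iff).mpr hY0),
        ← WithZero.exp_add, ← WithZero.exp_add, ← WithZero.exp_zero, WithZero.exp_le_exp]; omega)
    rw [hχ.map_pow_three hX, pow_two, hχ.map_mul hY0 hY0] at hsq
    rw [h1]; exact h3' _ hsq
  · -- `v Y ≤ 1`: `Y ± B` are integral
    rw [not_lt] at hYbig
    have hva : v (Y + B) ≤ 1 := (v.map_add Y B).trans (max_le hYbig hvB.le)
    have hvb : v (Y - B) ≤ 1 := (v.map_sub Y B).trans (max_le hYbig hvB.le)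
    by_cases hua : v (Y + B) = 1
    · by_cases hub : v (Y - B) = 1
      · -- both units: the finite check
        have hvX : v X = 1 := by
          have h3X : 3 * log (v X) = 0 := by rw [hua, hub, WithZero.log_one] at hlog; omega
          rw [← WithZero.exp_log ((v.ne_zero_iff).mpr hX), show log (v X) = 0 by omega, WithZero.exp_zero]
        exact hunits (Y + B) X hua (by rwa [show Y + B - 2 * B = Y - B by ring]) hvX hprod'
      · -- `Y - B` is the non-unit: `v(Y - B) = v(X)³ ≤ exp(-3)`, `Y + B ≡ 2B`
        have hlt : log (v (Y - B)) < 0 := by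
          have := lt_of_le_of_ne hvb hub
          rw [← WithZero.log_one]
          exact (WithZero.log_lt_log ((v.ne_zero_iff).mpr hb) one_ne_zero).mpr this
        have hle3 : log (v (Y - B)) ≤ -3 := by rw [hua, WithZero.log_one] at hlog; omega
        have hc : χ (Y + B) = χ (2 * B) := hχ.eq_of_le h2B (by
          rw [show Y + B - 2 * B = Y - B by ring, hv2B, one_mul,
            ← WithZero.exp_log ((v.ne_zero_iff).mpr hb), WithZero.exp_le_exp]; exact hle3)
        rw [hc, hχ2B]
    · -- `Y + B` is the non-unit: then `v(Y - B) = 1`, `v(Y + B) ≤ exp(-3)`, `Y - B ≡ -2B`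
      have hub : v (Y - B) = 1 := by
        by_contra hub
        have h1 : v (Y + B) < 1 := lt_of_le_of_ne hva hua
        have h2' : v (Y - B) < 1 := lt_of_le_of_ne hvb hub
        have : v (2 * B) < 1 := by
          rw [show (2 : L) * B = (Y + B) - (Y - B) by ring]
          exact v.map_sub_lt h1 h2'
        rw [hv2B] at this
        exact lt_irrefl _ this
      have hlt : log (v (Y + B)) < 0 := by
        have := lt_of_le_of_ne hva hua
        rw [← WithZero.log_one]
        exact (WithZero.log_lt_log ((v.ne_zero_iff).mpr ha) one_ne_zero).mpr this
      have hle3 : log (v (Y + B)) ≤ -3 := by rw [hub, WithZero.log_one] at hlog; omega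
      have hc : χ (Y - B) = χ (-(2 * B)) := hχ.eq_of_le (neg_ne_zero.mpr h2B) (by
        rw [show Y - B - -(2 * B) = Y + B by ring, Valuation.map_neg, hv2B, one_mul,
          ← WithZero.exp_log ((v.ne_zero_iff).mpr ha), WithZero.exp_le_exp]; exact hle3)
      rw [hc, hχ.map_neg h2B, hχ2B] at hsum
      exact h3 _ _ hsum rfl

end IsDigitChar

end MordellDescent

end Literature.NumberTheory.EllipticCurves
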